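import Literature.AnabelianGeometry.AbsoluteAnabelian.FreeProSigmaOpenSubgroups
import Literature.AnabelianGeometry.AbsoluteAnabelian.AbsTopIChains
import Literature.AnabelianGeometry.SemiGraphs.ProSigmaSurfaceTorsionFree
import Literature.AnabelianGeometry.SemiGraphs.ProSigmaSurfaceFreeProlRank
import HarnessLib

/-!
# [AbsTopI] Lemma 4.5 (i) AT THE MODELS: `CuspidalData.NonProperIffFree` holds for every extension whose
# `Δ` is a pro-`Σ` completion of a hyperbolic surface group `Γ_{g,r}` — affine (`r ≥ 1`) and proper (`r = 0`)

S. Mochizuki, *Topics in Absolute Anabelian Geometry I: Generalities* (2012) [AbsTopI] (lit key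
`paper:url-11ac98ba15fc`), Lemma 4.5 (i) p. 54: "`X` is non-proper if and only if every torsion-free
pro-`Σ` open subgroup of `Δ` is free pro-`Σ`."  abc-iut-L4-t4 typed it (policy θ) as the predicate
`FundamentalExtension.CuspidalData.NonProperIffFree C S` on abstract cuspidal data `C` of an abstract
extension `E` (FACT-LIST F-0208; `AbsTopIChains.lean`): `Nonempty C.Cusp ↔ ∀ H ≤ Δ` open in `Δ`,
torsion-free, pro-`Σ` `→ IsFreePro H S`.  Over ABSTRACT data the universal closure is refutable (the F-wave
seat abc-iut-f-060 records the schema refutation); THIS PROOF-ONLY FILE (no definitions, no named facts)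
proves the predicate at BOTH classes of MODELS the print is about — `Δ` presented as a pro-`Σ` completion
`ι : Γ_{g,r} → Δ` of a hyperbolic surface group ([SemiAnbd] Ex. 2.10, abc-iut-L3's `IsProSigmaCompletion`):

* AFFINE (`r ≥ 1`, i.e. `X` non-proper, cusps nonempty): `Δ` is free pro-`Σ` of rank `2g + r − 1 ≥ 2`, and
  EVERY open subgroup of `Δ` is free pro-`Σ` (abc-iut-L4-t15's `IsFreeProOn.isFreePro_of_isOpen`,
  `FreeProSigmaOpenSubgroups.lean`: Schreier) — so the right-hand side HOLDS:
  `nonProperIffFree_of_isFreeProOn`, `nonProperIffFree_of_isProSigmaCompletion_puncturedSurfaceGroup`;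
* PROPER (`r = 0`, `g ≥ 2`, no cusps): the right-hand side FAILS at `H = Δ` itself — `Δ` is open in `Δ`,
  torsion-free (abc-iut-L4-t15's `torsionFree_puncturedSurfaceGroup`, `ProSigmaSurfaceTorsionFree.lean`),
  pro-`Σ`, and NOT free pro-`Σ`: were it free of rank `m`, then `m = δ¹_ℓ(Δ) = 2g` (abc-iut-L4-d1's
  `freeProlRank_eq_of_surfaceGroup`) and a proper open subgroup `N` of index `i ≥ 2` (the kernel of a
  character `Δ → ℤ/ℓ` through the universal property) would have `δ¹_ℓ(N) = (2g − 1) i + 1` (Schreier,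
  `IsFreeProOn.freeProlRank_eq_of_isOpen`) and `= 2(g − 1) i + 2` (`freeProlRank_open_eq_of_surfaceGroup`),
  forcing `i = 1`: `nonProperIffFree_of_isProSigmaCompletion_closedSurfaceGroup`.

Also: `not_isFreePro_of_isProSigmaCompletion_surfaceGroup` (a pro-`Σ` completion of `S_g`, `g ≥ 2`, is not
free pro-`Σ` — the group form of the proper case) and `IsFreeProOn.of_continuousMulEquiv` (transport of
the L4 predicate along `≃ₜ*`, any universes).
HONEST SCOPE: MODEL-level (the abstract predicate stays a hypothesis elsewhere); `Σ` must contain a prime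
for the proper class; classical profinite group theory; nothing here bears on [IUTchIII] Cor. 3.12; typed ≠
proved elsewhere.
-/

noncomputable section

open Topology

universe u v

namespace Literature.AnabelianGeometry.AbsoluteAnabelian

open Literature.AnabelianGeometry.SemiGraphs.SemiGraphOfAnabelioids
open Literature.AnabelianGeometry.SemiGraphs.SemiGraphOfAnabelioids.IsProSigmaCompletion
open Literature.GroupTheory.CombinatorialGroupTheory

/-! ### Transport of `IsFreeProOn` along an isomorphism of topological groups -/

/-- `IsFreeProOn` is invariant under isomorphisms of topological groups: if `G` is free pro-`Σ` on `gens`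
and `e : G ≃ₜ* G'`, then `G'` is free pro-`Σ` on `e ∘ gens`. [cite: MochizukiAbsTopI2012, Lemma 4.5 (i) p.54] -/
theorem IsFreeProOn.of_continuousMulEquiv {G : Type u} [Group G] [TopologicalSpace G] {G' : Type v}
    [Group G'] [TopologicalSpace G'] {S : Set ℕ} {n : ℕ} {gens : Fin n → G}
    (h : IsFreeProOn G S gens) (e : G ≃ₜ* G') : IsFreeProOn G' S (fun i => e (gens i)) := by
  refine ⟨⟨fun U hU hUo q hq hdvd => ?_⟩, fun K _ _ _ _ hK f => ?_⟩
  · haveI := hU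
    haveI : (U.comap e.toMulEquiv.toMonoidHom).Normal := Subgroup.Normal.comap hU _
    have hUo' : IsOpen ((U.comap e.toMulEquiv.toMonoidHom : Subgroup G) : Set G) := hUo.preimage e.continuous
    have h1 := h.1.prime_dvd_index (U.comap e.toMulEquiv.toMonoidHom) inferInstance hUo' q hq
    rw [Subgroup.index_comap_of_surjective _ e.surjective] at h1
    exact h1 hdvd
  · obtain ⟨φ, ⟨hφc, hφgens⟩, hφu⟩ := h.2 K hK f
    refine ⟨φ.comp e.symm.toMulEquiv.toMonoidHom, ⟨hφc.comp e.symm.continuous, fun i => ?_⟩, ?_⟩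
    · change φ (e.symm (e (gens i))) = f i
      rw [e.symm_apply_apply]
      exact hφgens i
    · rintro ψ ⟨hψc, hψgens⟩
      have hψ' : ψ.comp e.toMulEquiv.toMonoidHom = φ :=
        hφu _ ⟨hψc.comp e.continuous, fun i => hψgens i⟩
      ext x
      change ψ x = φ (e.symm x)
      rw [← hψ']
      change ψ x = ψ (e (e.symm x))
      rw [e.apply_symm_apply]

namespace FundamentalExtension

variable {E : FundamentalExtension.{u}}

/-! ### The affine models: `Δ` free pro-`Σ` ⇒ every open subgroup of `Δ` is free pro-`Σ` -/

/-- **[AbsTopI] Lem 4.5 (i) at the AFFINE models, `IsFreeProOn` form**: if `Δ = E.geom` is free pro-`Σ` of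
rank `n ≥ 1` and the cuspidal data `C` has a cusp, then `C.NonProperIffFree S` holds — indeed EVERY open
subgroup `H ⊆ Δ` is free pro-`Σ` (Schreier), torsion-free or not.
[cite: MochizukiAbsTopI2012, Lemma 4.5 (i) p.54] -/
theorem CuspidalData.nonProperIffFree_of_isFreeProOn (C : CuspidalData E) [hC : Nonempty C.Cusp]
    {S : Set ℕ} {n : ℕ} {gens : Fin n → E.geom} (hΔ : IsFreeProOn E.geom S gens) (hn : 1 ≤ n) :
    C.NonProperIffFree S := by
  haveI : CompactSpace E.geom := isCompact_iff_compactSpace.mp E.isClosed_geom.isCompact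
  refine ⟨fun _ H hle hopen _ _ => ?_, fun _ => hC⟩
  obtain ⟨m, gens', hfree, -⟩ := hΔ.exists_isFreeProOn_of_isOpen hn (H.subgroupOf E.geom) hopen
  -- transport along `H.subgroupOf Δ ≃ₜ* H`
  let eUH : H.subgroupOf E.geom ≃ₜ* H :=
    { Subgroup.subgroupOfEquivOfLe hle with
      continuous_toFun :=
        (continuous_subtype_val.comp continuous_subtype_val).subtype_mk _
      continuous_invFun := (continuous_subtype_val.subtype_mk _).subtype_mk _ }
  exact ⟨m, _, hfree.of_continuousMulEquiv eUH⟩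

/-- **[AbsTopI] Lem 4.5 (i) at the AFFINE models**: for every extension `E` whose `Δ` is presented as a
pro-`Σ` completion `ι : Γ_{g,r} → Δ` of a hyperbolic punctured surface group with `r ≥ 1` (the datum of a
NON-PROPER hyperbolic curve of type `(g, r)`) and every cuspidal data `C` with a cusp, the typed predicate
`C.NonProperIffFree S` HOLDS. [cite: MochizukiAbsTopI2012, Lemma 4.5 (i) p.54] -/
theorem CuspidalData.nonProperIffFree_of_isProSigmaCompletion_puncturedSurfaceGroup (C : CuspidalData E)
    [Nonempty C.Cusp] {S : Set ℕ} {g r : ℕ} (hr : 1 ≤ r) (hgr : PuncturedSurfaceGroup.IsHyperbolicType g r)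
    (ι : PuncturedSurfaceGroup g r →* E.geom) (hι : IsProSigmaCompletion S ι) : C.NonProperIffFree S := by
  classical
  haveI : CompactSpace E.geom := isCompact_iff_compactSpace.mp E.isClosed_geom.isCompact
  obtain ⟨r', rfl⟩ : ∃ r', r = r' + 1 := ⟨r - 1, by omega⟩
  obtain ⟨e⟩ := PuncturedSurfaceGroup.nonempty_mulEquiv_freeGroup g r'
  -- `Δ` is the pro-`Σ` completion of `F_n`, `n = 2g + r'`
  set n : ℕ := Fintype.card ((Fin g × Bool) ⊕ Fin r') with hn
  let eα : ((Fin g × Bool) ⊕ Fin r') ≃ Fin n := Fintype.equivFin _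
  let e' : FreeGroup (Fin n) ≃* PuncturedSurfaceGroup g (r' + 1) :=
    (FreeGroup.freeGroupCongr eα.symm).trans e.symm
  let κ : FreeGroup (Fin n) →* E.geom := ι.comp e'.toMonoidHom
  have hκ : IsProSigmaCompletion S κ := hι.of_comp_mulEquiv e' fun _ => rfl
  have hlift : FreeGroup.lift (fun i => κ (FreeGroup.of i)) = κ :=
    FreeGroup.ext_hom _ _ fun i => FreeGroup.lift_apply_of
  have hκ' : IsProSigmaCompletion S (FreeGroup.lift fun i => κ (FreeGroup.of i)) := by
    rw [hlift]; exact hκ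
  have hΔ : IsFreeProOn E.geom S (fun i => κ (FreeGroup.of i)) :=
    isFreeProOn_of_isProSigmaCompletion_lift hκ'
  have hn1 : 1 ≤ n := by
    have hh : 2 < 2 * g + (r' + 1) := hgr
    simp only [hn, Fintype.card_sum, Fintype.card_prod, Fintype.card_fin, Fintype.card_bool]
    omega
  exact C.nonProperIffFree_of_isFreeProOn hΔ hn1

end FundamentalExtension

/-! ### The proper models: `Δ` a pro-`Σ` surface group is not free pro-`Σ` -/

/-- Schreier vs. Riemann–Hurwitz: `(2g − 1)·i + 1 ≠ 2(g − 1)·i + 2` for `i ≥ 2` (`g ≥ 1`). [folklore] -/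
private theorem rank_mismatch {g i : ℕ} (hg : 1 ≤ g) (hi : 2 ≤ i) :
    (2 * g - 1) * i + 1 ≠ 2 * (g - 1) * i + 2 := by
  have h1 : 2 * g - 1 = 2 * (g - 1) + 1 := by omega
  rw [h1, Nat.add_mul, one_mul]
  omega

/-- **A pro-`Σ` completion of a closed surface group `S_g` (`g ≥ 2`) is NOT free pro-`Σ`** (when `Σ`
contains a prime): were it free pro-`Σ` of rank `m`, then `m = δ¹_ℓ(P) = 2g` (abc-iut-L4-d1's
`freeProlRank_eq_of_surfaceGroup`), and the kernel `N` of a character `P → ℤ/ℓ` through the universal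
property (a proper open subgroup, index `i ≥ 2`) would have `δ¹_ℓ(N) = (2g − 1)·i + 1` (Schreier,
`IsFreeProOn.freeProlRank_eq_of_isOpen`) and `= 2(g − 1)·i + 2` (`freeProlRank_open_eq_of_surfaceGroup`),
forcing `i = 1`.  This is the group-theoretic content of the "only if" direction of [AbsTopI] Lem 4.5
(i) ("`X` non-proper ⟸ every torsion-free pro-`Σ` open subgroup of `Δ` is free pro-`Σ`").
[cite: MochizukiAbsTopI2012, Lemma 4.5 (i) p.54] -/
theorem not_isFreePro_of_isProSigmaCompletion_surfaceGroup {P : Type u} [Group P]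
    [TopologicalSpace P] [IsTopologicalGroup P] [CompactSpace P] [T2Space P]
    [TotallyDisconnectedSpace P] {Γ : Type v} [Group Γ] {ι : Γ →* P} {S : Set ℕ}
    (hι : IsProSigmaCompletion S ι) {g : ℕ} (hg : 2 ≤ g)
    (eΓ : Γ ≃* Literature.Topology.FourManifolds.SurfaceGroup g) (hS : ∃ ℓ ∈ S, ℓ.Prime) :
    ¬ IsFreePro P S := by
  classical
  rintro ⟨m, gens, hfree⟩
  obtain ⟨ℓ, hℓS, hℓ⟩ := hS
  haveI : Fact ℓ.Prime := ⟨hℓ⟩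
  -- the rank: `m = 2g`
  have hm : m = 2 * g := by
    have h1 := (hfree.freeProlRank_eq hℓS).symm.trans (freeProlRank_eq_of_surfaceGroup hι eΓ hℓS)
    exact_mod_cast h1
  have hm1 : 1 ≤ m := by omega
  -- a proper open subgroup: the kernel of `P → ℤ/ℓ`, `gens 0 ↦ 1`
  haveI : Fact (1 < ℓ) := ⟨hℓ.one_lt⟩
  letI : TopologicalSpace (Multiplicative (ZMod ℓ)) := ⊥
  haveI : DiscreteTopology (Multiplicative (ZMod ℓ)) := ⟨rfl⟩
  have hK : ∀ q : ℕ, q.Prime → q ∣ Nat.card (Multiplicative (ZMod ℓ)) → q ∈ S := by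
    intro q hq hdvd
    rw [Nat.card_eq_fintype_card, Fintype.card_multiplicative, ZMod.card] at hdvd
    rwa [(Nat.prime_dvd_prime_iff_eq hq hℓ).mp hdvd]
  obtain ⟨φ, ⟨hφc, hφgens⟩, -⟩ := hfree.2 (Multiplicative (ZMod ℓ)) hK fun _ => Multiplicative.ofAdd 1
  set N : Subgroup P := φ.ker with hNdef
  have hNo : IsOpen (N : Set P) := by
    change IsOpen (φ ⁻¹' {1})
    exact (isOpen_discrete _).preimage hφc
  haveI : Finite (P ⧸ N) := Subgroup.quotient_finite_of_isOpen N hNo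
  haveI hNfi : N.FiniteIndex := Subgroup.finiteIndex_of_finite_quotient
  have hNtop : N ≠ ⊤ := by
    intro htop
    have h0 : gens ⟨0, by omega⟩ ∈ N := by rw [htop]; exact Subgroup.mem_top _
    rw [hNdef, MonoidHom.mem_ker, hφgens] at h0
    exact one_ne_zero (ofAdd_eq_one.mp h0)
  have hi2 : 2 ≤ N.index := by
    have h0 : N.index ≠ 0 := hNfi.index_ne_zero
    have h1 : N.index ≠ 1 := fun h => hNtop (Subgroup.index_eq_one.mp h)
    omega
  -- two rank formulas at `N`
  have h2 := hfree.freeProlRank_eq_of_isOpen hm1 hℓS N hNo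
  have h3 := freeProlRank_open_eq_of_surfaceGroup hι hg eΓ hℓS N hNo
  have h4 : (m - 1) * N.index + 1 = 2 * (g - 1) * N.index + 2 := by
    exact_mod_cast h2.symm.trans h3
  rw [hm] at h4
  exact rank_mismatch (by omega) hi2 h4

namespace FundamentalExtension

variable {E : FundamentalExtension.{u}}

/-- **[AbsTopI] Lem 4.5 (i) at the PROPER models**: for every extension `E` whose `Δ` is presented as a
pro-`Σ` completion `ι : Γ_{g,0} → Δ` of a CLOSED surface group of genus `g ≥ 2` (the datum of a PROPER
hyperbolic curve), `Σ` containing a prime, and every cuspidal data `C` WITHOUT cusps, the typed predicate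
`C.NonProperIffFree S` HOLDS — because its right-hand side FAILS at `H = Δ`: `Δ` is torsion-free
(`torsionFree_puncturedSurfaceGroup`), pro-`Σ` and open in itself, but not free pro-`Σ`
(`not_isFreePro_of_isProSigmaCompletion_surfaceGroup`). [cite: MochizukiAbsTopI2012, Lemma 4.5 (i) p.54] -/
theorem CuspidalData.nonProperIffFree_of_isProSigmaCompletion_closedSurfaceGroup (C : CuspidalData E)
    [hC : IsEmpty C.Cusp] {S : Set ℕ} (hS : ∃ ℓ ∈ S, ℓ.Prime) {g : ℕ} (hg : 2 ≤ g)
    (ι : PuncturedSurfaceGroup g 0 →* E.geom) (hι : IsProSigmaCompletion S ι) : C.NonProperIffFree S := by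
  classical
  haveI : CompactSpace E.geom := isCompact_iff_compactSpace.mp E.isClosed_geom.isCompact
  obtain ⟨eΓ⟩ := nonempty_mulEquiv_puncturedSurfaceGroup_zero g
  refine ⟨fun hne => (hC.false hne.some).elim, fun hRHS => ?_⟩
  exfalso
  -- apply the right-hand side to `H := Δ`
  have hopen : IsOpen ((E.geom.subgroupOf E.geom : Subgroup E.geom) : Set E.geom) := by
    rw [Subgroup.subgroupOf_self]; exact isOpen_univ
  have htf : ∀ x : E.geom, IsOfFinOrder x → x = 1 := torsionFree_puncturedSurfaceGroup (Or.inr hg) hι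
  have hpro : IsProSet E.geom S :=
    ⟨fun U hU hUo q hq hdvd => (hι.index_open U hU hUo).2 q hq hdvd⟩
  exact not_isFreePro_of_isProSigmaCompletion_surfaceGroup hι hg eΓ hS (hRHS E.geom le_rfl hopen htf hpro)

end FundamentalExtension

end Literature.AnabelianGeometry.AbsoluteAnabelian

end
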